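import Mathlib
import HarnessLib
import HarnessLib.Audit
import Summits.MatrixMultiplication.Statement
import Literature.Computability.AlgebraicComplexity.GroupTheoreticMatMulProofs
import Literature.Computability.AlgebraicComplexity.GroupTheoreticMatMulThmBProofs
import Literature.Computability.AlgebraicComplexity.PrattTrapezoidValSDPP
import Literature.Computability.AlgebraicComplexity.FlatteningBound
import HarnessLib.Audit.Status.Attr

/-!
Route: FourierTwoFamiliesModP

DORMANT since 2026-08-24T15:53:28Z (reconciler: no traction for 6.9 d (last activity item-evidence-added at 2026-08-17T18:18:30Z); parked, not closed — `ledger route dormant route-MatrixMultiplication-FourierTwoFamiliesModP --off` to re) — unstaffed, not closed; items shared with open routes are served there. `ledger route dormant <id> --off` reactivates.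

# Route FourierTwoFamiliesModP — two-families designs mod p decide omega = 2; linear Fourier
analysis of the SDPP system is the kill engine

It suffices to show X = PrimeTwoFamilies: the two-families conjecture of
Cohn–Kleinberg–Szegedy–Umans (CKSU 2005 Conj. 4.7) holds
with PRIME CYCLIC hosts — for every δ > 0 and arbitrarily large n there are a prime p ≤ n^(2+δ) and
n pairs (A_i, B_i) of subsets of
ℤ/pℤ with the simultaneous double product property ((W) each A_i ⊕ B_i direct; (X) (a − a′) + (b −
b′) = 0 with a ∈ A_i, a′ ∈ A_j,
b ∈ B_j, b′ ∈ B_k forces i = k) and |A_i||B_i| ≥ n^(2−δ). The deciding theorem `closes :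
PrimeTwoFamilies → MatrixMultiplication`
is PROVED sorry-free in the route file from tree theorems (CKSU §4/§6 corner-free construction +
Behrend + CKSU Thm 5.5 abelian).
Prime cyclic hosts lose nothing: support CyclicReduction says X ↔ the all-abelian Conj. 4.7
(verbatim GroupTheoreticSTPP.CPackingConstruction,
stmt-0595) by Umans' cyclic reduction (arXiv:2309.03878 p.10) made effective. The route is TWO-SIDED
and its ENGINE SITS ON THE KILL
SIDE (card fourier-two-families-half-density): the SDPP system has Fourier complexity 1, and the
kill-side statements (support items since the crux-only repair of
2026-08-16; formerly the ranked cruxes) are the rungs of an L²-Fourier / density-increment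
refutation in ℤ/pℤ — PrimeCyclicPowerGain (its proof refutes X by support PowerGainRefutes, hence
refutes stmt-0595 by CyclicReduction) above PrimeLogDecay above PrimeDensityDecay (whose regime n ≤
K·s is support RemovalRegime,
from Green's removal lemma PROVED in tree). Calibration found while planning (support
WallBreachModP, provable now): the "matched-
difference wall" n·s² ≤ C·p conjectured by the gen-1 route is FALSE even in ℤ/pℤ — CRT images of
CKSU Prop 4.5 over pairwise-coprime
moduli are SDPP designs in CYCLIC groups with n·s²/N ≈ 2^l/√(πl) → ∞ (verified: N = 2520, n = 6, s =
24, ratio 1.37; lifted to the prime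
60077, ratio 1.125), so the kill engine must be a density statement, not an interval endgame. It is
NOT claimed that the kill-side statements bear
positively on ω = 2; under the crux-only rule the route's ONLY crux is X = PrimeTwoFamilies itself
(sole hypothesis of `closes`), and the negative side of X is worked in its disprover lane, which has
PowerGainRefutes_proof.
Lean: `∀ δ : ℝ, 0 < δ → ∀ n₀ : ℕ, ∃ n ≥ n₀, ∃ p : ℕ, p.Prime ∧ ∃ A B : Fin n → Finset (ZMod p), (∀ i
: Fin n, ∀ a ∈ A i, ∀ a' ∈ A i, ∀ b ∈ B i, ∀ b' ∈ B i, (a - a') + (b - b') = 0 → a = a' ∧ b = b') ∧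
(∀ i j k : Fin n, ∀ a ∈ A i, ∀ a' ∈ A j, ∀ b ∈ B j, ∀ b' ∈ B k, (a - a') + (b - b') = 0 → i = k) ∧
(p : ℝ) ≤ (n : ℝ) ^ (2 + δ) ∧ ∀ i : Fin n, (n : ℝ) ^ (2 - δ) ≤ (((A i).card * (B i).card : ℕ) : ℝ)`

## Assembly
Deciding theorem (D-0027 §2.1), PROVED sorry-free in the route file (folder/ClosesTest.lean rc 0;
axioms propext, Classical.choice,
Quot.sound; 120 tactic lines): `theorem closes (hT : PrimeTwoFamilies) : MatrixMultiplication`. If ω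
:= omega ℂ > 2, put ε := ω − 2
∈ (0, 1] (omega_two_le, omega_le_three') and δ = η := ε/8; X gives SDPP pairs in ℤ/p with p ≤
n^(2+δ), |A_i||B_i| ≥ n^(2−δ) and n
beyond the Behrend threshold and 64^(1/ε); the CKSU §4/§6 family (A_{v₁} × {0} × B_{v₃}, B_{v₁} ×
A_{v₂} × {0}, {0} × B_{v₂} × A_{v₃})
on a corner-free index configuration of size ≥ n^(2−η)/64 (tree: addSimultaneousTPP_of_sdpp,
exists_cornerFree_indexMaps_card_ge) is
an STPP family in (ℤ/p)³ (AddSimultaneousTPP.comp + isSTPP_iff_addSimultaneousTPP after reindexing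
by Fin N); CKSU Thm 5.5 abelian
(CohnKleinbergSzegedyUmans2005_5_5_abelian_holds) gives (n^(2−η)/64)·n^((2−δ)ω) ≤ p³ ≤ n^(6+3δ),
i.e. (9ε/8)·log n ≤ log 64 —
contradiction. No Literature fact is assumed, so X alone decides ω(ℂ) = 2. The kill ladder composes
OFF the deciding theorem:
PrimeCyclicPowerGain → PrimeLogDecay (s^(−c) ≤ (log s)^(−c)) → PrimeDensityDecay (s₀ =
exp(ε^(−1/c))); RemovalRegime is the
n ≤ K·s half of PrimeDensityDecay; PrimeCyclicPowerGain → ¬PrimeTwoFamilies (PowerGainRefutes) →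
¬stmt-0595 (CyclicReduction).

UNDER FLOOR: fewer than 2 cruxes remain after retriage (legacy route; D-0019).

Rationale: WHY THIS LINE. The abelian group-theoretic programme (CohnKleinbergSzegedyUmans2005 Conj. 4.7 / Thm.
5.5; BlasiakChurchCohnGrochowNaslundSawinUmans2017
Thm. B kills bounded exponent, PROVED in tree) is alive exactly in hosts of unbounded exponent, and
Pratt2023 (arXiv:2309.03878 p.3)
asks verbatim "Could one achieve ω = 2 using cyclic groups?"; p.10 records (crediting Umans) that
Conj. 4.7, if true at all, is true
in cyclic groups — the digit map ⊕ℤ_{m_t} → ℤ preserves (W),(X) (4-term sums never carry),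
near-extremal hosts have few small cyclic
factors by the slice-rank bound, and Bertrand lifts [0, N) into ℤ/pℤ, p ≤ 4N — so PRIME cyclic hosts
are without loss, and there the
SDPP system, a family of single equations a + b = a′ + b′ with index constraints (true complexity 1,
GowersWolf2010TrueComplexity), is
controlled by LINEAR Fourier analysis with every nonzero frequency of full order and Bohr sets =
arithmetic progressions. Imported area:
additive combinatorics / discrete harmonic analysis (Parseval–Cauchy–Schwarz identities,
Roth–Bourgain density increment, KelleyMeka2023
/ BloomSisask2020 spectral technology, Green2005 arithmetic removal — the latter PROVED in tree as
Green2005_1_5_holds and already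
settling PrimeDensityDecay in the regime n ≤ K·s). New relative to the retired gen-1 route
FourierTwoFamilies (not-a-thesis) and to
route GroupTheoreticSTPP: (i) a deciding theorem — two-families designs mod p ALONE give ω(ℂ) = 2,
proved from tree theorems
(addSimultaneousTPP_of_sdpp, exists_cornerFree_indexMaps_card_ge,
CohnKleinbergSzegedyUmans2005_5_5_abelian_holds, omega_two_le);
(ii) the all-abelian layer of the card (coset induction; power gain capped at c < 0.17 by CKSU Prop.
4.5 in (ℤ/3)^(2l)) is replaced by
the bookkeeping item CyclicReduction, so the analytic crux lives only in ℤ/pℤ, where every fixed c <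
1 is consistent with all known
designs (translates, digit images, and the CRT designs found here, which breach c = 1 itself); (iii)
the negatives index (1 entry,
DesignFlattening) and all 60 sibling routes contain no analytic statement about SDPP families.

RANKED CRUXES. Crux-only repair 2026-08-16 (route-repair unused-crux): the deciding chain is `closes
: PrimeTwoFamilies → MatrixMultiplication` (proved), so PrimeTwoFamilies is the route's only crux;
the kill ladder #2–#4 cannot feed `closes` (it yields ¬PrimeTwoFamilies via PowerGainRefutes) and
was re-kinded crux → support rather than dropped, because landed Theorems name those decls
(PrimeDensityDecay/Negative/LoadBearing `crux_iff`, PrimeWlog, CollisionProfileRemovalStubs;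
PrimeLogDecay/Negative/LoadBearing `primeLogDecay_iff`; FourierTwoFamiliesModPPowerGainRefutes);
they stay provable free-standing supports and their proofs keep the KILL CRITERIA meaning. #0
PrimeTwoFamilies (crux; auto-crux 2026-08-16, formerly target) — CKSU Conj. 4.7 with prime cyclic
hosts: ∀ δ > 0, for arbitrarily large n, a prime p ≤ n^(2+δ) and n SDPP pairs in ℤ/pℤ with
|A_i||B_i| ≥ n^(2−δ) (deciding side; equivalent to stmt-0595 by CyclicReduction). (why it might
fail: Probably false (the route's own engine bets so): every known SDPP design in ℤ/p — translates,
digit images, CRT cubes — has density ns/p → 0 fast, i.e. |A_i||B_i| far below n^(2−δ) at p ≤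
n^(2+δ); and Pratt Thm 4.7 + any Val(ℤ_N) = O(N^(4/3−ε)) bound kills it outright.)
[CohnKleinbergSzegedyUmans2005, Pratt2023, BlasiakChurchCohnGrochowNaslundSawinUmans2017, Beker2025]
#2 PrimeCyclicPowerGain (support since 2026-08-16; kill side, formerly crux rank 2) — fixed power
saving in ℤ/pℤ: ∃ c > 0, s₀ such that every balanced SDPP configuration (n pairs, |A_i| = |B_i| = s
≥ s₀, (W), (X)) in any ℤ/pℤ has n·s^(1+c) ≤ p (card crux C1; the whole refutation modulo
PowerGainRefutes + CyclicReduction). [difficulty: open-problem] (why it might fail: Density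
increments give log-type savings (Behrend), not powers; the forced bias ρ = ns/p may be polynomially
small (≥ s^(−c)), so a Roth/Kelley–Meka iteration survives O(1) steps — an energy/multiplicative
increment from the family structure is needed and unwritten.) [CohnKleinbergSzegedyUmans2005,
Pratt2023, KelleyMeka2023, BloomSisask2020, GowersWolf2010TrueComplexity]
#3 PrimeLogDecay (support since 2026-08-16; kill-ladder milestone, formerly crux rank 3) —
quantitative density decay in ℤ/pℤ (card milestone C3, "one Bohr/Chang step beyond the forced
bias"): ∃ c > 0, s₀ such that every balanced SDPP configuration in ℤ/pℤ with s ≥ s₀ has n·s·(log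
s)^c ≤ p, i.e. density ns/p ≤ (log s)^(−c); implied by PrimeCyclicPowerGain, implies
PrimeDensityDecay. [difficulty: XL] (why it might fail: The forced bias sits at ONE frequency for
the whole family while the n sets tilt to different arcs, so the Roth step must increment a family
functional, unwritten; and the true decay could be slower than every log-power (density 1/2 is
attained at s = 2: n = ⌊p/4⌋ pairs).) [CohnKleinbergSzegedyUmans2005, KelleyMeka2023,
BloomSisask2020, GowersWolf2010TrueComplexity]
#4 PrimeDensityDecay (support since 2026-08-16; kill-ladder milestone, formerly crux rank 4) —
qualitative Roth-type theorem for the SDPP system in ℤ/pℤ: ∀ ε > 0 ∃ s₀, every balanced SDPP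
configuration with s ≥ s₀ has n·s ≤ ε·p (the families fill a vanishing fraction of the group;
HalfDensity gives ε = 1/2 + 1/(2s); the regime n ≤ K·s is support RemovalRegime, from Green's
removal lemma PROVED in tree; the open part is n ≫ s). [difficulty: L] (why it might fail: In the
regime n ≫ s removal only bounds s, and an increment needs a relative half-density on long
progressions nobody has written; it could be false via fat designs with ns/p ≥ ε₀ and s → ∞ (none
known: translates 1/(2s), digit and CRT images → 0 fast).) [Green2005,
CohnKleinbergSzegedyUmans2005, KelleyMeka2023, arXiv:math/0310476]
#9 PowerGainRefutes (support) — the kill link, provable now: PrimeCyclicPowerGain →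
¬PrimeTwoFamilies (take δ < c/(3+2c); pairwise disjointness gives Σ|A_i|, Σ|B_i| ≤ p, Markov twice
leaves ≥ n/2 indices with |A_i|, |B_i| ≤ 4p/n, hence min(|A_i|,|B_i|) ≥ n^(1−2δ)/4 =: s; shrink to
size s (IsSDPP.mono), reindex (IsSDPP.reindex), apply the power gain: (n/2)(n^(1−2δ)/4)^(1+c) ≤
n^(2+δ), false for large n). [difficulty: provable-now] [CohnKleinbergSzegedyUmans2005, Pratt2023]
#9 CyclicReduction (support) — Umans' cyclic reduction made effective (Pratt2023 p.10, mechanism of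
the proof of Thm 4.7): CKSU Conj 4.7 over all finite abelian groups (verbatim the text of
GroupTheoreticSTPP.CPackingConstruction, stmt-0595) ↔ PrimeTwoFamilies. (←) H := ZMod p. (→)
carry-free mixed-radix map H ≅ ⊕ℤ/m_t → [0, R) ⊂ ℤ with radices 2m_t − 1 preserves (W),(X) and
sizes, R ≤ 2^k|H|; k = #cyclic factors ≤ log_L|H| + Σ_{q≤L} r_q with r_q = O(δ log n) for
near-extremal families by the slice-rank bound on (ℤ/q)^(r_q)-components (tree:
exists_pi_zmod_decomp, sum_card_div_le_of_addEquiv_piZMod, as in pratt2024_thm47_aux); Bertrand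
gives a prime p ∈ (2R, 4R] and [0,R) ↪ ℤ/p keeps (W),(X). [difficulty: L] [Pratt2023,
BlasiakChurchCohnGrochowNaslundSawinUmans2017, CohnKleinbergSzegedyUmans2005]
#9 RemovalRegime (support) — density decay in the regime n ≤ K·s, every finite abelian group,
provable now from Green2005_1_5_holds (k = 3): with X = ⊔A_i, Y = ⊔B_i, D = ∪_i(A_i − B_i), (W)+(X)
make x − y = d have EXACTLY Σ|A_i||B_i| = ns² ≤ |H|^(3/2) = o(|H|²) solutions; removing ≤ ε|H|
elements from each set kills ≤ ε|H|·s + ε|H|·s + ε|H|·n of them (an element of X or Y lies in s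
solutions, d ∈ D in ≤ n by (W)), so ns² ≤ ε|H|(2s + n) and n ≤ Ks gives ns ≤ ε(2+K)|H| (grounder
g14-11's derivation on stmt-5963). [difficulty: provable-now] [Green2005, Pratt2023]
#9 WallBreachModP (support) — calibration, provable now — the prime-cyclic wall (moot stmt-5964: ∃
C, n·s² ≤ C·p for balanced SDPP in ℤ/p) is FALSE: for every C there are a prime p and a balanced
SDPP configuration in ℤ/pℤ with n·s² > C·p. Construction (planner, verified numerically in
folder/crt_wall.py): moduli m_t = (2l)!·t + 1 (t ≤ 2l) are pairwise coprime (a prime dividing two of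
them divides t − t′ ≤ 2l, hence (2l)!), so H = ⊕ℤ/m_t ≅ ℤ/N is CYCLIC (ZMod.chineseRemainder); CKSU
Prop 4.5 sets A_S = {x : x_t ≠ 0 ⟺ t ∈ S}, B_S = A_(S^c) over the 2^l index sets S choosing one
coordinate from each pair (2u−1, 2u) form an SDPP family; shrink all to s = ∏_u (m_(2u−1) − 1)
(IsSDPP.mono): n·s²/N ≈ 2^l/√(πl); lift [0, N) ↪ ℤ/p for a prime p ∈ (2N, 4N]
(Nat.exists_prime_lt_and_le_two_mul; sums < 2N < p so (W),(X) persist): ratio ≥ 2^l/(4√(πl)) → ∞.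
[difficulty: provable-now] [CohnKleinbergSzegedyUmans2005, Pratt2023, Behrend1946]
#9 HalfDensity (support) — half-density theorem, balanced form, every finite abelian group: (W),
(X), |A_i| = |B_i| = s ≥ 1 ⇒ 2·n·s² ≤ |H|·(s+1) (general form: αβ − |H|n ≤ √(α(|H|−α)β(|H|−β)), α =
Σ|A_i|, β = Σ|B_i|; tight on single factorisations A ⊕ B = H). Proof: with f = Σ1_{A_i}, g =
Σ1_{B_i}, D = Σ_i 1_{A_i} ∗ 1_{−B_i} (≤ n pointwise by (W)), (X) is the exact identity ⟨f ∗ ǧ, D⟩ =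
Σ D²; write f ∗ ǧ = αβ/|H| + (f − α/|H|) ∗ (ǧ − β/|H|) and use Σ D² ≤ n·Σ D, |⟨u ∗ v, D⟩| ≤ (Σ
D)·‖u‖₂‖v‖₂ — elementary, no characters needed (identical to moot stmt-5966, grounded and reviewed).
[difficulty: provable-now] [CohnKleinbergSzegedyUmans2005, GowersWolf2010TrueComplexity]
#9 CommonFrequencyBias (support) — forced common-frequency bias beyond the wall, every finite
abelian group: (W), (X), |A_i| = |B_i| = s ≥ 1 and |H| < n·s² ⇒ a nontrivial character ψ with
n·s·(n·s² − |H|) ≤ (|H| − n·s)·|Σ_i Â_i(ψ)·conj(B̂_i(ψ))|, i.e. relative bias ≥ (ρ − 1/s)/(1 − ρ), ρ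
= ns/|H|, of the pair family at ONE frequency (random level ≈ 1/s) — the inverse-theorem input of
every increment (same identity, the error term bounded on the Fourier side by
max_{ψ≠1}|D̂(ψ)|·‖u‖₂‖v‖₂; identical to moot stmt-5967, grounded and reviewed). [difficulty:
provable-now] [CohnKleinbergSzegedyUmans2005, KelleyMeka2023]

TWO-LAYER PLAN. Foreseen glued splits (none filed now; k ≤ 3, depth 1). PrimeDensityDecay ⇐
RemovalRegime (already an item: n ≤ K·s for every fixed K)
→ IncrementRegime (n ≥ K·s: a relative HalfDensity inside a long arithmetic progression +
CommonFrequencyBias ⟹ a balanced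
sub-configuration on a progression of length ≥ c(ρ)·p with relative density ×(1 + cρ), iterated
while ρ ≥ ε) → PrimeDensityDecay.
PrimeLogDecay ⇐ ChangStep (the large spectrum of D = Σ_i 1_{A_i} ∗ 1_{−B_i} has bounded dimension at
relative bias ≈ ρ; Chang /
Bloom–Sisask) → BohrRecursion (the configuration restricted to a Bohr set of rank O(ρ^(−2)) keeps
(W),(X) and a constant fraction of
the mass) → PrimeLogDecay. PrimeCyclicPowerGain ⇐ EnergyIncrement (the common-frequency bias
upgraded to an additive-energy increment
of ⊔A_i, affordable at polynomially small ρ) → StructuredEndgame (near-extremal configurations are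
CRT/Bohr cubes like WallBreachModP's,
whose density is superpolynomially small in s) → PrimeCyclicPowerGain. CyclicReduction ⇐
CarryFreeLift (SDPP is preserved by the
mixed-radix map and by [0,R) ↪ ℤ/p, p > 2R) → FewSmallFactors (near-extremal two-families hosts have
Σ_{q≤L} r_q = O_L(δ log n),
from the tree's slice-rank input) → CyclicReduction. The deciding side is not split: no construction
mechanism is claimed; should the
kill side stall with structured dense near-extremisers, their blueprint becomes a construction item
shared with route
AutomaticSTPPDesigns (digit-automatic families, Bertrand-lifted into ℤ/p) — the CRT cubes of
WallBreachModP show that cyclic hosts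
DO carry overlapping-difference SDPP designs (multiplicity-n matched differences), the shape the
card asked constructors to try.

KILL CRITERIA. PrimeCyclicPowerGain PROVED ⟹ PowerGainRefutes refutes the target: close
`refuted:PrimeTwoFamilies` — the intended informative end
(with CyclicReduction it also closes stmt-0595 = GroupTheoreticSTPP.CPackingConstruction as refuted
and adds a Fourier entry for
unbounded-exponent abelian hosts next to TricoloredSumFreeBarrier). PrimeDensityDecay REFUTED
(balanced configurations in ℤ/p with
s → ∞ at density ≥ ε₀) ⟹ PrimeLogDecay and PrimeCyclicPowerGain are false too and the Fourier engine
is dead: the witnesses are by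
far the best SDPP designs known; re-rank the route to the deciding side with their blueprint as a
construction item, or close
`refuted:PrimeDensityDecay` if nothing constructive remains. PrimeLogDecay refuted alone (decay
slower than every log-power) ⟹ drop it
and PrimeCyclicPowerGain, keep PrimeDensityDecay as the negative milestone. Target refuted directly
(EisensteinValCertificates.
PrimeFourThirdsSaving + Pratt Thm 4.7 = pratt2024_thm47_holds, or CAbelianObstructionNeg stmt-0596
proved) ⟹ close
`refuted:PrimeTwoFamilies`. stmt-0595 PROVED elsewhere ⟹ X follows by CyclicReduction and `closes`
gives ω = 2: close
`superseded --by route-MatrixMultiplication-GroupTheoreticSTPP`.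

NOT DECOMPOSED YET. The increment lemmas themselves (relative half-density on progressions and Bohr
sets, the Chang step, the energy increment, the
structured endgame) — layer-2 children once PrimeDensityDecay or PrimeLogDecay shows which potential
moves; the unbalanced versions
(PowerGainRefutes makes balanced suffice); explicit constants c, s₀; the general (unbalanced)
half-density inequality
αβ − |H|n ≤ √(α(|H|−α)β(|H|−β)) and the general bias inequality M(αβ − n|H|) ≤
|D̂(ψ)|·√(α(|H|−α)β(|H|−β)) (they ride with
HalfDensity / CommonFrequencyBias via `--supports`); the all-abelian and composite-cyclic
DensityDecay (moot after CyclicReduction,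
but RemovalRegime is already stated for every finite abelian group); the two halves of
CyclicReduction as separate lemmas; the moot
wall item stmt-5964 itself (its negation WallBreachModP is filed instead; re-filing a statement
known to be false would be churn);
the sequel "general STPP = complexity-2 system, U³ / quadratic Fourier analysis" (another card) —
out of scope until a crux closes.

CHEAPEST FALSIFIER. Kill side (run first): a STRUCTURED search for DENSE balanced SDPP
configurations in ℤ/pℤ — maximise the density ns/p for s ∈ {3,4,5,6},
p ≤ 200 over translate families, CRT/digit images of CKSU Prop 4.5 and their unions, plus exact DFS
at p ≤ 61 (random greedy is useless:
folder dense_search.py finds fewer pairs than translates). Watch max density as s grows: 1/2 is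
attained at s = 2 (gen-1 exact census
n_max(p) = ⌊p/4⌋, p ≤ 19; refuter kit job j000755 smoke N = 7, 8, 11, 13 → 1, 2, 2, 3); max density
≥ 0.3 persisting for s = 3..6 makes
PrimeDensityDecay / PrimeLogDecay doubtful, a 1/s-type decay supports the ladder. SETTLED while
planning: the wall n·s² ≤ C·p is false
(WallBreachModP; folder crt_wall.py: ℤ/2520, n = 6, s = 24, ratio 1.371, SDPP brute-forced; ℤ/30030
→ prime 60077, n = 4, s = 130,
ratio 1.125; families with ratio ≈ 2^l/√(πl)). Deciding side: the lookup "is any Val(ℤ_N) =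
O(N^(4/3−ε)) bound or Pratt Conj 4.1
proved?" (no: Beker2025, arXiv:2404.07380 — the skew-corner proxy is dead); a yes kills X by Pratt
Thm 4.7 (pratt2024_thm47_holds, in tree).

NUMBERS. Trivial: ns ≤ p (pairwise disjointness, tree IsSDPP.sum_card_left_le), s² ≤ p ((W),
IsSDPP.card_mul_card_le). HalfDensity: 2ns² ≤ p(s+1),
i.e. density ns/p ≤ 1/2 + 1/(2s); attained 1/2 at s = 2 (n_max(p) = ⌊p/4⌋ for p ∈ {7, 11, 13, 17,
19}, gen-1 exact census).
Translates of one direct pair (A = [0,s), B = s·[0,s), shifts 2s² apart): n·s² ≈ p/2, density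
1/(2s). Digit images of CKSU Prop 4.5
((ℤ/m)^(2l), base 2m−1) in ℤ/p: n·s²/p ≈ (4(m−1)²/(2m−1)²)^l/(2√(πl)) → 0, density → 0, n·s^(1+c) ≤
p for every c ≤ 1. CRT images
(this session, WallBreachModP): pairwise-coprime moduli make ⊕ℤ/m_t cyclic at NO cost — (m_t) =
(5,7,8,9): ℤ/2520, n = 6, s = 24,
n·s²/N = 1.371, density 0.057; (11,13,14,15): ℤ/30030, n = 4, s = 130, ratio 2.251, lifted to the
prime 60077: ratio 1.125, density
0.0087; family m_t = (2l)!·t + 1 with one index per adjacent pair: n = 2^l, ratio ≈ 2^l/√(πl) = 2.5,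
7.9, 50.3, 660 for l = 3, 5, 8, 12
(÷4 after the Bertrand lift); 2l primes in [m, 1.25m] with all l-subsets: l = 8, m = 3000: ratio
10658, density 1.5·10^(−24). So the
wall is dead, while every fixed c < 1 in PrimeCyclicPowerGain and every log-power in PrimeLogDecay
is consistent with all known
designs (their densities are 1/(2s), (8/25)^l-type and 2^l·m^(−l)-type). All-abelian calibration
(why CyclicReduction matters): CKSU
Prop 4.5 in (ℤ/3)^(2l) caps an all-abelian power gain at c ≤ 0.1699 (0.262 for m = 4, 0.322 for m =
5); these hosts reach ℤ/p only
through digit maps, where the cap disappears. Conjecture regime: p ≤ n^(2+δ), |A_i||B_i| ≥ n^(2−δ);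
after balancing s ≥ n^(1−2δ)/4,
n′ ≥ n/2, density ≥ n^(−3δ)/8; PowerGainRefutes needs δ < c/(3+2c). Deciding theorem: δ = η =
(ω−2)/8, exponent margin 9(ω−2)/8,
threshold n > max(Behrend n₁, 64^(1/(ω−2))). CyclicReduction cost: host inflation ≤ 4·2^k (k =
number of cyclic factors; 4·3^k with
Pratt's radix 3m_t), k ≤ log_L|H| + Σ_{q≤L} r_q. Forced bias (CommonFrequencyBias): relative (ρ −
1/s)/(1 − ρ), ρ = ns/p, versus
≈ 1/s for random s-sets. Items at open: 11 (1 target, 1 assembly, 3 cruxes, 6 support); after the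
2026-08-16 crux-only repair: 1 crux (PrimeTwoFamilies), 1 assembly, 9 support.

DEFINITION REQUESTS. None. `Literature.Computability.AlgebraicComplexity.IsSDPP` (CKSU Def 4.1,
additive) exists with `isSDPP_iff : IsSDPP A B ↔ (W) ∧ (X)` by
Iff.rfl; every item inlines (W),(X) verbatim as stmt-0595 does, so provers may rewrite freely. Tools
in tree: AddChar H ℂ,
AddChar.sum_apply_eq_ite / AddChar.card_eq (Mathlib/Analysis/Fourier/FiniteAbelian), ZMod.dft;
Behrend (Mathlib) and
SalemSpencerModular; Green2005_1_5_holds (ArithmeticRemovalProofs). No cite facts needed: every item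
is self-contained over Mathlib.

Novelty: Searches (2026-08-15): `lit read arxiv:2309.03878 --grep 'cyclic group|Umans for informing|two
families|Fourier|Bohr|increment'` (4 hits:
p.3 "Could one achieve ω = 2 using cyclic groups?", p.10 Umans' remark + proof of Thm 4.7; 0 hits
for Fourier/Bohr/increment);
`lit read arxiv:math/0511460` pp. 7–11 (Def 20 = Def 4.1, Lemma 21, Thm 22–23, Prop 24–25, Conj 26 =
Conj 4.7, Def 27, Thm 31 = Thm 5.5,
§6 triangle-free subsets of Δ_n, Lemma 35); `lit search "simultaneous double product property two
families conjecture"` (searchd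
unavailable this session, rc 75 — relying on the same-day searches recorded on the gen-1 route and
by grounder g14-11 / refuter review:
`lit galaxy search "two families conjecture" --star all` 0 hits, `"simultaneous double product
property"` 3 hits (CKSU05, Stothers 2010
thesis ×2), pdf "double product property" 4, `lit search --hybrid` 12 held docs (only Landsberg 2017
expository), `lit frontier
MatrixMultiplication --since 2021` / `lit bridges --cross any` nothing on SDPP, `lit citing
arxiv:math/0511460 --since 2019` 49 works
(SDPP-relevant: arXiv:2309.03878, 2404.07380, 2402.19169)); `lean search IsSDPP` (tree API found),
tree files PrattTrapezoidVal*.lean read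
(Thm 4.7 PROVED in tree: pratt2024_thm47_holds).
Nearest prior art found: Pratt2023 (arXiv:2309.03878) — Prop 2.6 (disjointness / induced-matching
reformulation of SDPP), Thm 4.7
(Conj 4.7 ⟹ Val(ℤ_n) ≥ n^(4/3−ε), a combinatorial obstruction programme) and the p.10 remark
crediting Umans (Conj 4.  [refs: 2309.03878, math/0511460, arxiv:2309.03878, arxiv:math/0511460, Pratt2023, CohnKleinbergSzegedyUmans2005, BlasiakChurchCohnGrochowNaslundSawinUmans2017]

Barriers (technique_class: STPP-abelian-unbounded-exponent, fourier-density-increment): - technique_class: STPP-abelian-unbounded-exponent, fourier-density-increment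
- Literature.Barriers.MatrixMultiplication.TricoloredSumFreeBarrier: does not bite either side.
Deciding side: hosts ℤ/pℤ have exponent p → ∞ (forced anyway: p ≥ s² ≥ n^(2−δ)), so
`TricoloredSumFreeBarrier.not_beats_of_exponent_le` /
BlasiakChurchCohnGrochowNaslundSawinUmans2017_B_holds are vacuous, and ℤ/p has full slice rank
(BlasiakChurchCohnGrochowUmans2017 Thm B.8) with Behrend-size tricolored sum-free sets — the
barrier's declared blind spot (evasions_known (a)). Kill side: works IN that blind spot with a
different engine (L² Fourier analysis of a complexity-1 system, not slice rank) and aims to extend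
the barrier's conclusion to the two-families line there; the slice-rank input is used only inside
CyclicReduction, to count small cyclic factors exactly as Pratt Thm 4.7 does.
- Literature.Barriers.MatrixMultiplication.EquivoluminousBarrier: does not bite (no CW §11
hypothesis is used); same genre warning — an additive-combinatorial hypothesis for ω = 2 met by
counting/analysis.
- Literature.Barriers.MatrixMultiplication.NilpotentGroupBarrier: n/a — abelian hosts only; the
complexity-2 sequel (general STPP, quadratic Fourier analysis) would start where its non-abelian
bounded-exponent hosts live.
- Literature.Barriers.MatrixMultiplication.NormalizerBarrier: n/a — no subgroup TPP triples
(BlasiakCohnGrochowPrattUmans2023 §3 concerns non-abelian subgroup constructions).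
- Literature.Barriers.Matri

History (route lifecycle, newest last):
- 2026-08-16T04:10:46Z · AUTO-CRUX (backfill): PrimeTwoFamilies — hypotheses of the deciding theorem that nothing in the route derives are cruxes (operator:999:1085951)
- 2026-08-24T15:53:28Z · DORMANT — reconciler: no traction for 6.9 d (last activity item-evidence-added at 2026-08-17T18:18:30Z); parked, not closed — `ledger route dormant route-MatrixMultiplica (operator:999:2201337)

sub-problem: MatrixMultiplication · status: dormant · opened planner-plancard-MatrixMultiplication-MatrixM-116d40f8-g2-0 2026-08-15T19:07:23Z · rev 3 · ledger route-MatrixMultiplication-FourierTwoFamiliesModP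
GENERATED by the gate from the ledger (D-0016/17). Provers cite these decls: `theorem foo : Summit.MatrixMultiplication.MatrixMultiplication.Theses.FourierTwoFamiliesModP.<Decl> := …` in Summits/MatrixMultiplication/MatrixMultiplication/Theorems/<Name>.lean.
-/

namespace Summit.MatrixMultiplication.MatrixMultiplication.Theses.FourierTwoFamiliesModP

open scoped BigOperators Topology Manifold Classical MeasureTheory ProbabilityTheory Matrix InnerProductSpace ComplexConjugate ContinuousMap
open Filter Set Function TopologicalSpace MeasureTheory

attribute [summit_statement] _root_.MatrixMultiplication

/-- item stmt-MatrixMultiplication-14308 · crux (kind.auto-crux: conjecture-grade) · rank 0 · open · by planner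
why it might fail: Probably false (the route's own engine bets so): every known SDPP design in ℤ/p — translates, digit images, CRT cubes — has density ns/p → 0 fast, i.e. |A_i||B_i| far below n^(2−δ) at p ≤ n^(2+δ); and Pratt Thm 4.7 + any Val(ℤ_N) = O(N^(4/3−ε)) bound kills it outright.
sources: CohnKleinbergSzegedyUmans2005, Pratt2023, BlasiakChurchCohnGrochowNaslundSawinUmans2017, Beker2025
[target] CKSU Conj. 4.7 with prime cyclic hosts: ∀ δ > 0, for arbitrarily large n, a prime p ≤
n^(2+δ) and n SDPP pairs in ℤ/pℤ with |A_i||B_i| ≥ n^(2−δ) (deciding side; equivalent to stmt-0595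
by CyclicReduction). -/
@[route_item "route-MatrixMultiplication-FourierTwoFamiliesModP", crux]
def PrimeTwoFamilies : Prop :=
  ∀ δ : ℝ, 0 < δ → ∀ n₀ : ℕ, ∃ n ≥ n₀, ∃ p : ℕ, p.Prime ∧ ∃ A B : Fin n → Finset (ZMod p), (∀ i : Fin n, ∀ a ∈ A i, ∀ a' ∈ A i, ∀ b ∈ B i, ∀ b' ∈ B i, (a - a') + (b - b') = 0 → a = a' ∧ b = b') ∧ (∀ i j k : Fin n, ∀ a ∈ A i, ∀ a' ∈ A j, ∀ b ∈ B j, ∀ b' ∈ B k, (a - a') + (b - b') = 0 → i = k) ∧ (p : ℝ) ≤ (n : ℝ) ^ (2 + δ) ∧ ∀ i : Fin n, (n : ℝ) ^ (2 - δ) ≤ (((A i).card * (B i).card : ℕ) : ℝ)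

/-- item stmt-MatrixMultiplication-14309 · support · rank 2 · open · by planner
why it might fail: Density increments give log-type savings (Behrend), not powers; the forced bias ρ = ns/p may be polynomially small (≥ s^(−c)), so a Roth/Kelley–Meka iteration survives O(1) steps — an energy/multiplicative increment from the family structure is needed and unwritten.
sources: CohnKleinbergSzegedyUmans2005, Pratt2023, KelleyMeka2023, BloomSisask2020, GowersWolf2010TrueComplexity
[crux] fixed power saving in ℤ/pℤ: ∃ c > 0, s₀ such that every balanced SDPP configuration (n pairs,
|A_i| = |B_i| = s ≥ s₀, (W), (X)) in any ℤ/pℤ has n·s^(1+c) ≤ p (card crux C1; the whole refutation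
modulo PowerGainRefutes + CyclicReduction). [difficulty: open-problem] -/
@[route_item "route-MatrixMultiplication-FourierTwoFamiliesModP", crux]
def PrimeCyclicPowerGain : Prop :=
  ∃ c : ℝ, 0 < c ∧ ∃ s₀ : ℕ, ∀ p : ℕ, p.Prime → ∀ (n s : ℕ) (A B : Fin n → Finset (ZMod p)), s₀ ≤ s → (∀ i : Fin n, (A i).card = s ∧ (B i).card = s) → (∀ i : Fin n, ∀ a ∈ A i, ∀ a' ∈ A i, ∀ b ∈ B i, ∀ b' ∈ B i, (a - a') + (b - b') = 0 → a = a' ∧ b = b') → (∀ i j k : Fin n, ∀ a ∈ A i, ∀ a' ∈ A j, ∀ b ∈ B j, ∀ b' ∈ B k, (a - a') + (b - b') = 0 → i = k) → (n : ℝ) * (s : ℝ) ^ (1 + c) ≤ (p : ℝ)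

/-- item stmt-MatrixMultiplication-14310 · support · rank 3 · open · by planner
why it might fail: The forced bias sits at ONE frequency for the whole family while the n sets tilt to different arcs, so the Roth step must increment a family functional, unwritten; and the true decay could be slower than every log-power (density 1/2 is attained at s = 2: n = ⌊p/4⌋ pairs).
sources: CohnKleinbergSzegedyUmans2005, KelleyMeka2023, BloomSisask2020, GowersWolf2010TrueComplexity
[crux] quantitative density decay in ℤ/pℤ (card milestone C3, "one Bohr/Chang step beyond the forced
bias"): ∃ c > 0, s₀ such that every balanced SDPP configuration in ℤ/pℤ with s ≥ s₀ has n·s·(log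
s)^c ≤ p, i.e. density ns/p ≤ (log s)^(−c); implied by PrimeCyclicPowerGain, implies
PrimeDensityDecay. [difficulty: XL] -/
@[route_item "route-MatrixMultiplication-FourierTwoFamiliesModP", crux]
def PrimeLogDecay : Prop :=
  ∃ c : ℝ, 0 < c ∧ ∃ s₀ : ℕ, ∀ p : ℕ, p.Prime → ∀ (n s : ℕ) (A B : Fin n → Finset (ZMod p)), s₀ ≤ s → (∀ i : Fin n, (A i).card = s ∧ (B i).card = s) → (∀ i : Fin n, ∀ a ∈ A i, ∀ a' ∈ A i, ∀ b ∈ B i, ∀ b' ∈ B i, (a - a') + (b - b') = 0 → a = a' ∧ b = b') → (∀ i j k : Fin n, ∀ a ∈ A i, ∀ a' ∈ A j, ∀ b ∈ B j, ∀ b' ∈ B k, (a - a') + (b - b') = 0 → i = k) → (n : ℝ) * (s : ℝ) * Real.log (s : ℝ) ^ c ≤ (p : ℝ)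

/-- item stmt-MatrixMultiplication-14311 · support · rank 4 · open · by planner
why it might fail: In the regime n ≫ s removal only bounds s, and an increment needs a relative half-density on long progressions nobody has written; it could be false via fat designs with ns/p ≥ ε₀ and s → ∞ (none known: translates 1/(2s), digit and CRT images → 0 fast).
sources: Green2005, CohnKleinbergSzegedyUmans2005, KelleyMeka2023, arXiv:math/0310476
[crux] qualitative Roth-type theorem for the SDPP system in ℤ/pℤ: ∀ ε > 0 ∃ s₀, every balanced SDPP
configuration with s ≥ s₀ has n·s ≤ ε·p (the families fill a vanishing fraction of the group;
HalfDensity gives ε = 1/2 + 1/(2s); the regime n ≤ K·s is support RemovalRegime, from Green's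
removal lemma PROVED in tree; the open part is n ≫ s). [difficulty: L] -/
@[route_item "route-MatrixMultiplication-FourierTwoFamiliesModP"]
def PrimeDensityDecay : Prop :=
  ∀ ε : ℝ, 0 < ε → ∃ s₀ : ℕ, ∀ p : ℕ, p.Prime → ∀ (n s : ℕ) (A B : Fin n → Finset (ZMod p)), s₀ ≤ s → (∀ i : Fin n, (A i).card = s ∧ (B i).card = s) → (∀ i : Fin n, ∀ a ∈ A i, ∀ a' ∈ A i, ∀ b ∈ B i, ∀ b' ∈ B i, (a - a') + (b - b') = 0 → a = a' ∧ b = b') → (∀ i j k : Fin n, ∀ a ∈ A i, ∀ a' ∈ A j, ∀ b ∈ B j, ∀ b' ∈ B k, (a - a') + (b - b') = 0 → i = k) → (n : ℝ) * (s : ℝ) ≤ ε * (p : ℝ)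

/-- item stmt-MatrixMultiplication-14312 · support · rank 9 · closed · proved by Summit.MatrixMultiplication.MatrixMultiplication.Theorems.PowerGainRefutes_proof @ df2c8ec66bc9 (prover) · by planner
sources: CohnKleinbergSzegedyUmans2005, Pratt2023
[support] the kill link, provable now: PrimeCyclicPowerGain → ¬PrimeTwoFamilies (take δ < c/(3+2c);
pairwise disjointness gives Σ|A_i|, Σ|B_i| ≤ p, Markov twice leaves ≥ n/2 indices with |A_i|, |B_i|
≤ 4p/n, hence min(|A_i|,|B_i|) ≥ n^(1−2δ)/4 =: s; shrink to size s (IsSDPP.mono), reindex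
(IsSDPP.reindex), apply the power gain: (n/2)(n^(1−2δ)/4)^(1+c) ≤ n^(2+δ), false for large n).
[difficulty: provable-now] -/
@[route_item "route-MatrixMultiplication-FourierTwoFamiliesModP"]
def PowerGainRefutes : Prop :=
  PrimeCyclicPowerGain → ¬ PrimeTwoFamilies

/-- item stmt-MatrixMultiplication-14313 · support · rank 9 · closed · proved by Summit.MatrixMultiplication.MatrixMultiplication.Theorems.cyclicReduction_proof (prover) · by planner
sources: Pratt2023, BlasiakChurchCohnGrochowNaslundSawinUmans2017, CohnKleinbergSzegedyUmans2005
[support] Umans' cyclic reduction made effective (Pratt2023 p.10, mechanism of the proof of Thm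
4.7): CKSU Conj 4.7 over all finite abelian groups (verbatim the text of
GroupTheoreticSTPP.CPackingConstruction, stmt-0595) ↔ PrimeTwoFamilies. (←) H := ZMod p. (→)
carry-free mixed-radix map H ≅ ⊕ℤ/m_t → [0, R) ⊂ ℤ with radices 2m_t − 1 preserves (W),(X) and
sizes, R ≤ 2^k|H|; k = #cyclic factors ≤ log_L|H| + Σ_{q≤L} r_q with r_q = O(δ log n) for
near-extremal families by the slice-rank bound on (ℤ/q)^(r_q)-components (tree:
exists_pi_zmod_decomp, sum_card_div_le_of_addEquiv_piZMod, as in pratt2024_thm47_aux); Bertrand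
gives a prime p ∈ (2R, 4R] and [0,R) ↪ ℤ/p keeps (W),(X). [difficulty: L] -/
@[route_item "route-MatrixMultiplication-FourierTwoFamiliesModP"]
def CyclicReduction : Prop :=
  (∀ δ : ℝ, 0 < δ → ∀ n₀ : ℕ, ∃ n ≥ n₀, ∃ (H : Type) (_ : AddCommGroup H) (_ : Fintype H) (A B : Fin n → Finset H), (∀ i : Fin n, ∀ a ∈ A i, ∀ a' ∈ A i, ∀ b ∈ B i, ∀ b' ∈ B i, (a - a') + (b - b') = 0 → a = a' ∧ b = b') ∧ (∀ i j k : Fin n, ∀ a ∈ A i, ∀ a' ∈ A j, ∀ b ∈ B j, ∀ b' ∈ B k, (a - a') + (b - b') = 0 → i = k) ∧ (Fintype.card H : ℝ) ≤ (n : ℝ) ^ (2 + δ) ∧ ∀ i : Fin n, (n : ℝ) ^ (2 - δ) ≤ (((A i).card * (B i).card : ℕ) : ℝ)) ↔ PrimeTwoFamilies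

/-- item stmt-MatrixMultiplication-14314 · support · rank 9 · closed · proved by Summit.MatrixMultiplication.MatrixMultiplication.Theorems.removalRegime_proof @ f6d72d5a6b5c (prover) · by planner
sources: Green2005, Pratt2023
[support] density decay in the regime n ≤ K·s, every finite abelian group, provable now from
Green2005_1_5_holds (k = 3): with X = ⊔A_i, Y = ⊔B_i, D = ∪_i(A_i − B_i), (W)+(X) make x − y = d
have EXACTLY Σ|A_i||B_i| = ns² ≤ |H|^(3/2) = o(|H|²) solutions; removing ≤ ε|H| elements from each
set kills ≤ ε|H|·s + ε|H|·s + ε|H|·n of them (an element of X or Y lies in s solutions, d ∈ D in ≤ n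
by (W)), so ns² ≤ ε|H|(2s + n) and n ≤ Ks gives ns ≤ ε(2+K)|H| (grounder g14-11's derivation on
stmt-5963). [difficulty: provable-now] -/
@[route_item "route-MatrixMultiplication-FourierTwoFamiliesModP"]
def RemovalRegime : Prop :=
  ∀ K ε : ℝ, 0 < ε → ∃ s₀ : ℕ, ∀ (H : Type) [AddCommGroup H] [Fintype H] (n s : ℕ) (A B : Fin n → Finset H), s₀ ≤ s → (n : ℝ) ≤ K * (s : ℝ) → (∀ i : Fin n, (A i).card = s ∧ (B i).card = s) → (∀ i : Fin n, ∀ a ∈ A i, ∀ a' ∈ A i, ∀ b ∈ B i, ∀ b' ∈ B i, (a - a') + (b - b') = 0 → a = a' ∧ b = b') → (∀ i j k : Fin n, ∀ a ∈ A i, ∀ a' ∈ A j, ∀ b ∈ B j, ∀ b' ∈ B k, (a - a') + (b - b') = 0 → i = k) → (n : ℝ) * (s : ℝ) ≤ ε * (Fintype.card H : ℝ)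

/-- item stmt-MatrixMultiplication-14315 · support · rank 9 · closed · proved by Summit.MatrixMultiplication.MatrixMultiplication.Theorems.wallBreachModP_proof @ a099a07ea8e6 (prover) · by planner
sources: CohnKleinbergSzegedyUmans2005, Pratt2023, Behrend1946
[support] calibration, provable now — the prime-cyclic wall (moot stmt-5964: ∃ C, n·s² ≤ C·p for
balanced SDPP in ℤ/p) is FALSE: for every C there are a prime p and a balanced SDPP configuration in
ℤ/pℤ with n·s² > C·p. Construction (planner, verified numerically in folder/crt_wall.py): moduli m_t
= (2l)!·t + 1 (t ≤ 2l) are pairwise coprime (a prime dividing two of them divides t − t′ ≤ 2l, hence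
(2l)!), so H = ⊕ℤ/m_t ≅ ℤ/N is CYCLIC (ZMod.chineseRemainder); CKSU Prop 4.5 sets A_S = {x : x_t ≠ 0
⟺ t ∈ S}, B_S = A_(S^c) over the 2^l index sets S choosing one coordinate from each pair (2u−1, 2u)
form an SDPP family; shrink all to s = ∏_u (m_(2u−1) − 1) (IsSDPP.mono): n·s²/N ≈ 2^l/√(πl); lift
[0, N) ↪ ℤ/p for a prime p ∈ (2N, 4N] (Nat.exists_prime_lt_and_le_two_mul; sums < 2N < p so (W),(X)
persist): ratio ≥ 2^l/(4√(πl)) → ∞. [difficulty: provable-now] -/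
@[route_item "route-MatrixMultiplication-FourierTwoFamiliesModP"]
def WallBreachModP : Prop :=
  ∀ C : ℝ, ∃ p : ℕ, p.Prime ∧ ∃ (n s : ℕ) (A B : Fin n → Finset (ZMod p)), (∀ i : Fin n, (A i).card = s ∧ (B i).card = s) ∧ (∀ i : Fin n, ∀ a ∈ A i, ∀ a' ∈ A i, ∀ b ∈ B i, ∀ b' ∈ B i, (a - a') + (b - b') = 0 → a = a' ∧ b = b') ∧ (∀ i j k : Fin n, ∀ a ∈ A i, ∀ a' ∈ A j, ∀ b ∈ B j, ∀ b' ∈ B k, (a - a') + (b - b') = 0 → i = k) ∧ C * (p : ℝ) < (n : ℝ) * (s : ℝ) ^ 2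

/-- item stmt-MatrixMultiplication-14316 · support · rank 9 · closed · proved by Summit.MatrixMultiplication.MatrixMultiplication.Theorems.halfDensity_proof @ a18757bb5860 (prover) · by planner
sources: CohnKleinbergSzegedyUmans2005, GowersWolf2010TrueComplexity
[support] half-density theorem, balanced form, every finite abelian group: (W), (X), |A_i| = |B_i| =
s ≥ 1 ⇒ 2·n·s² ≤ |H|·(s+1) (general form: αβ − |H|n ≤ √(α(|H|−α)β(|H|−β)), α = Σ|A_i|, β = Σ|B_i|;
tight on single factorisations A ⊕ B = H). Proof: with f = Σ1_{A_i}, g = Σ1_{B_i}, D = Σ_i 1_{A_i} ∗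
1_{−B_i} (≤ n pointwise by (W)), (X) is the exact identity ⟨f ∗ ǧ, D⟩ = Σ D²; write f ∗ ǧ = αβ/|H| +
(f − α/|H|) ∗ (ǧ − β/|H|) and use Σ D² ≤ n·Σ D, |⟨u ∗ v, D⟩| ≤ (Σ D)·‖u‖₂‖v‖₂ — elementary, no
characters needed (identical to moot stmt-5966, grounded and reviewed). [difficulty: provable-now] -/
@[route_item "route-MatrixMultiplication-FourierTwoFamiliesModP"]
def HalfDensity : Prop :=
  ∀ (H : Type) [AddCommGroup H] [Fintype H] (n s : ℕ) (A B : Fin n → Finset H), 1 ≤ s → (∀ i : Fin n, (A i).card = s ∧ (B i).card = s) → (∀ i : Fin n, ∀ a ∈ A i, ∀ a' ∈ A i, ∀ b ∈ B i, ∀ b' ∈ B i, (a - a') + (b - b') = 0 → a = a' ∧ b = b') → (∀ i j k : Fin n, ∀ a ∈ A i, ∀ a' ∈ A j, ∀ b ∈ B j, ∀ b' ∈ B k, (a - a') + (b - b') = 0 → i = k) → 2 * n * s ^ 2 ≤ Fintype.card H * (s + 1)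

/-- item stmt-MatrixMultiplication-14317 · support · rank 9 · closed · proved by Summit.MatrixMultiplication.MatrixMultiplication.Theorems.CommonFrequencyBias_proof (prover) · by planner
sources: CohnKleinbergSzegedyUmans2005, KelleyMeka2023
[support] forced common-frequency bias beyond the wall, every finite abelian group: (W), (X), |A_i|
= |B_i| = s ≥ 1 and |H| < n·s² ⇒ a nontrivial character ψ with n·s·(n·s² − |H|) ≤ (|H| − n·s)·|Σ_i
Â_i(ψ)·conj(B̂_i(ψ))|, i.e. relative bias ≥ (ρ − 1/s)/(1 − ρ), ρ = ns/|H|, of the pair family at ONE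
frequency (random level ≈ 1/s) — the inverse-theorem input of every increment (same identity, the
error term bounded on the Fourier side by max_{ψ≠1}|D̂(ψ)|·‖u‖₂‖v‖₂; identical to moot stmt-5967,
grounded and reviewed). [difficulty: provable-now] -/
@[route_item "route-MatrixMultiplication-FourierTwoFamiliesModP"]
def CommonFrequencyBias : Prop :=
  ∀ (H : Type) [AddCommGroup H] [Fintype H] (n s : ℕ) (A B : Fin n → Finset H), 1 ≤ s → (∀ i : Fin n, (A i).card = s ∧ (B i).card = s) → (∀ i : Fin n, ∀ a ∈ A i, ∀ a' ∈ A i, ∀ b ∈ B i, ∀ b' ∈ B i, (a - a') + (b - b') = 0 → a = a' ∧ b = b') → (∀ i j k : Fin n, ∀ a ∈ A i, ∀ a' ∈ A j, ∀ b ∈ B j, ∀ b' ∈ B k, (a - a') + (b - b') = 0 → i = k) → Fintype.card H < n * s ^ 2 → ∃ ψ : AddChar H ℂ, ψ ≠ 1 ∧ ((n : ℝ) * (s : ℝ)) * ((n : ℝ) * (s : ℝ) ^ 2 - (Fintype.card H : ℝ)) ≤ ((Fintype.card H : ℝ) - (n : ℝ) * (s : ℝ)) * ‖∑ i : Fin n,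 (∑ a ∈ A i, ψ a) * (starRingEnd ℂ) (∑ b ∈ B i, ψ b)‖

/-- item stmt-MatrixMultiplication-14318 · assembly · rank 1 · closed · proved by Summit.MatrixMultiplication.MatrixMultiplication.Theorems.fourierTwoFamiliesModP_assembly_proof @ fb5d3ae678ca (prover) · by planner
sources: CohnKleinbergSzegedyUmans2005, Pratt2023
[assembly] PrimeTwoFamilies → MatrixMultiplication (exactly the type of `closes`, which proves it). -/
@[route_item "route-MatrixMultiplication-FourierTwoFamiliesModP"]
def Assembly : Prop :=
  PrimeTwoFamilies → MatrixMultiplication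

/-! D-0027 §2.1 — DECIDING THEOREM (planner-authored via `route open/edit --closes-file`; by planner-plancard-MatrixMultiplication-MatrixM-116d40f8-g2-0 2026-08-15T19:07:23Z):
its hypotheses are this route's items and its conclusion the sub-problem Statement (glue_lint), and it elaborates with this file. -/

/-- DECIDING THEOREM (D-0027 §2.1): prime-cyclic two-families designs decide `ω(ℂ) = 2`.
`ω ≥ 2` is the flattening bound (`omega_two_le`, tree). If `ω > 2`, put `ε := ω − 2 ∈ (0,1]`
(`omega_le_three'`), `δ = η := ε/8`; the target gives SDPP pairs `(Aᵢ,Bᵢ)_{i<n}` in `ℤ/p` with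
`p ≤ n^{2+δ}`, `|Aᵢ||Bᵢ| ≥ n^{2−δ}` for `n` as large as we please; the CKSU 2005 §4/§6 construction on a
Behrend corner-free index set (tree: `addSimultaneousTPP_of_sdpp`, `exists_cornerFree_indexMaps_card_ge`,
≥ n^{2−η}/64 triples) is an STPP family in `(ℤ/p)³` whose packing sum at exponent `ω/3` is
`≥ (n^{2−η}/64)·n^{(2−δ)ω}`, while CKSU Thm 5.5 (abelian; tree theorem
`CohnKleinbergSzegedyUmans2005_5_5_abelian_holds`) bounds it by `p³ ≤ n^{6+3δ}`: taking logarithms,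
`(9ε/8)·log n ≤ log 64`, false for `n` large. No Literature fact is assumed. -/
@[closes "route-MatrixMultiplication-FourierTwoFamiliesModP"] theorem closes (hT : PrimeTwoFamilies) : MatrixMultiplication := by
  rw [MatrixMultiplication_iff]
  by_contra hne
  have hω2 : (2 : ℝ) < Literature.Computability.AlgebraicComplexity.omega ℂ :=
    lt_of_le_of_ne (Literature.Computability.AlgebraicComplexity.omega_two_le ℂ) (Ne.symm hne)
  have hω3 : Literature.Computability.AlgebraicComplexity.omega ℂ ≤ 3 :=
    Literature.Computability.AlgebraicComplexity.omega_le_three' ℂ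
  set ω : ℝ := Literature.Computability.AlgebraicComplexity.omega ℂ with hωdef
  set ε : ℝ := ω - 2 with hε
  have hεpos : 0 < ε := by rw [hε]; linarith
  have hε1 : ε ≤ 1 := by rw [hε]; linarith
  set δ : ℝ := ε / 8 with hδ
  have hδpos : 0 < δ := by positivity
  have hδ1 : δ ≤ 1 := by rw [hδ]; linarith
  -- corner-free index configurations (Behrend), with `η := δ`
  obtain ⟨n₁, hn₁⟩ :=
    Literature.Computability.AlgebraicComplexity.exists_cornerFree_indexMaps_card_ge δ hδpos hδ1
  -- the size threshold beyond which the exponent count is contradictory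
  set n₂ : ℕ := ⌈Real.exp (Real.log 64 / ε)⌉₊ with hn₂
  -- the SDPP configuration in `ℤ/p`
  obtain ⟨n, hn, p, hp, A, B, hW, hX, hpn, hAB⟩ := hT δ hδpos (n₁ + n₂ + 2)
  have hn1nat : 1 < n := by omega
  have hnpos : (0 : ℝ) < n := by exact_mod_cast (show 0 < n by omega)
  have hn1 : (1 : ℝ) < n := by exact_mod_cast hn1nat
  have hℓnpos : 0 < Real.log n := Real.log_pos hn1
  -- `log 64 < ε · log n`
  have hbig : Real.log 64 < ε * Real.log n := by
    have h1 : Real.exp (Real.log 64 / ε) < n := by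
      have h2 := Nat.le_ceil (Real.exp (Real.log 64 / ε))
      have h3 : (⌈Real.exp (Real.log 64 / ε)⌉₊ : ℝ) < n := by
        exact_mod_cast (show n₂ < n by omega)
      linarith
    have h4 := Real.log_lt_log (Real.exp_pos _) h1
    rw [Real.log_exp, div_lt_iff₀ hεpos] at h4
    linarith
  -- the corner-free index maps into `Fin n`
  obtain ⟨ι₀, _inst1, _inst2, j₁, j₂, j₃, hι₀, hcf⟩ := hn₁ n (by omega)
  -- the CKSU STPP family in `(ℤ/p)³`
  haveI : Fact p.Prime := ⟨hp⟩
  have hS := Literature.Computability.AlgebraicComplexity.addSimultaneousTPP_of_sdpp hW hX j₁ j₂ j₃ hcf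
  set N : ℕ := Fintype.card ι₀ with hN
  set e : Fin N ≃ ι₀ := (Fintype.equivFin ι₀).symm with he
  have hS' := hS.comp e.injective
  set A' : Fin N → Finset (ZMod p × ZMod p × ZMod p) :=
    fun y => A (j₁ (e y)) ×ˢ (({0} : Finset (ZMod p)) ×ˢ B (j₃ (e y))) with hA'
  set B' : Fin N → Finset (ZMod p × ZMod p × ZMod p) :=
    fun y => B (j₁ (e y)) ×ˢ (A (j₂ (e y)) ×ˢ ({0} : Finset (ZMod p))) with hB'
  set C' : Fin N → Finset (ZMod p × ZMod p × ZMod p) :=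
    fun y => ({0} : Finset (ZMod p)) ×ˢ (B (j₂ (e y)) ×ˢ A (j₃ (e y))) with hC'
  have hSTPP : Literature.Computability.AlgebraicComplexity.IsSTPP A' B' C' :=
    (Literature.Computability.AlgebraicComplexity.isSTPP_iff_addSimultaneousTPP A' B' C').2 hS'
  -- CKSU Thm 5.5 (abelian case, tree theorem)
  have h55 := Literature.Computability.AlgebraicComplexity.CohnKleinbergSzegedyUmans2005_5_5_abelian_holds
    (ZMod p × ZMod p × ZMod p) N A' B' C' hSTPP
  -- the host has `p³ ≤ n^{3(2+δ)}` elements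
  have hcardH : (Fintype.card (ZMod p × ZMod p × ZMod p) : ℝ) = (p : ℝ) ^ 3 := by
    rw [Fintype.card_prod, Fintype.card_prod, ZMod.card]
    push_cast
    ring
  have hppos : (0 : ℝ) < p := by exact_mod_cast hp.pos
  -- each term of the packing sum is at least `Y ^ ω` with `Y = n^{2-δ}` cubed inside
  set Y : ℝ := (n : ℝ) ^ (2 - δ) with hY
  have hYpos : 0 < Y := Real.rpow_pos_of_pos hnpos _
  have hterm : ∀ y : Fin N,
      (Y ^ 3) ^ (ω / 3) ≤ (((A' y).card * (B' y).card * (C' y).card : ℕ) : ℝ) ^ (ω / 3) := by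
    intro y
    refine Real.rpow_le_rpow (by positivity) ?_ (by linarith)
    have hprod : (((A' y).card * (B' y).card * (C' y).card : ℕ) : ℝ) =
        (((A (j₁ (e y))).card * (B (j₁ (e y))).card : ℕ) : ℝ) *
          (((A (j₂ (e y))).card * (B (j₂ (e y))).card : ℕ) : ℝ) *
          (((A (j₃ (e y))).card * (B (j₃ (e y))).card : ℕ) : ℝ) := by
      simp only [hA', hB', hC', Finset.card_product, Finset.card_singleton]
      push_cast
      ring
    rw [hprod, pow_three']
    have h1 := hAB (j₁ (e y))
    have h2 := hAB (j₂ (e y))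
    have h3 := hAB (j₃ (e y))
    have hmul12 : Y * Y ≤ (((A (j₁ (e y))).card * (B (j₁ (e y))).card : ℕ) : ℝ) *
        (((A (j₂ (e y))).card * (B (j₂ (e y))).card : ℕ) : ℝ) :=
      mul_le_mul h1 h2 hYpos.le (hYpos.le.trans h1)
    calc Y * Y * Y ≤ (((A (j₁ (e y))).card * (B (j₁ (e y))).card : ℕ) : ℝ) *
          (((A (j₂ (e y))).card * (B (j₂ (e y))).card : ℕ) : ℝ) * Y :=
          mul_le_mul_of_nonneg_right hmul12 hYpos.le
      _ ≤ _ := mul_le_mul_of_nonneg_left h3 ((mul_pos hYpos hYpos).le.trans hmul12)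
  -- summing: `N · (Y³)^{ω/3} ≤ p³`
  have hsum : (N : ℝ) * (Y ^ 3) ^ (ω / 3) ≤ (p : ℝ) ^ 3 := by
    have h1 : ∑ _y : Fin N, (Y ^ 3) ^ (ω / 3) ≤
        ∑ y : Fin N, (((A' y).card * (B' y).card * (C' y).card : ℕ) : ℝ) ^ (ω / 3) :=
      Finset.sum_le_sum fun y _ => hterm y
    rw [Finset.sum_const, Finset.card_univ, Fintype.card_fin, nsmul_eq_mul] at h1
    rw [← hcardH]
    exact h1.trans h55
  -- `(Y³)^{ω/3} = n^{(2-δ)ω}`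
  have hYω : (Y ^ 3) ^ (ω / 3) = (n : ℝ) ^ ((2 - δ) * ω) := by
    rw [hY, ← Real.rpow_natCast ((n : ℝ) ^ (2 - δ)) 3, ← Real.rpow_mul hnpos.le,
      ← Real.rpow_mul hnpos.le]
    congr 1
    push_cast
    ring
  -- logarithms
  have hNpos : (0 : ℝ) < N := by
    have h : (0 : ℝ) < (n : ℝ) ^ (2 - δ) := Real.rpow_pos_of_pos hnpos _
    by_contra h0
    push Not at h0
    have h0' : (N : ℝ) = 0 := le_antisymm h0 (Nat.cast_nonneg _)
    rw [h0', mul_zero] at hι₀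
    exact absurd hι₀ (not_le.2 h)
  have hlogN : (2 - δ) * Real.log n - Real.log 64 ≤ Real.log N := by
    have h1 := Real.log_le_log (Real.rpow_pos_of_pos hnpos _) hι₀
    rw [Real.log_rpow hnpos, Real.log_mul (by norm_num) hNpos.ne'] at h1
    linarith
  have hlogp : Real.log p ≤ (2 + δ) * Real.log n := by
    have h1 := Real.log_le_log hppos hpn
    rwa [Real.log_rpow hnpos] at h1
  have hmain : Real.log N + (2 - δ) * ω * Real.log n ≤ 3 * Real.log p := by
    have hpow : (0 : ℝ) < (Y ^ 3) ^ (ω / 3) := Real.rpow_pos_of_pos (pow_pos hYpos 3) _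
    have h1 := Real.log_le_log (mul_pos hNpos hpow) hsum
    rw [Real.log_mul hNpos.ne' hpow.ne', hYω, Real.log_rpow hnpos, Real.log_pow] at h1
    push_cast at h1
    linarith
  -- the exponent count: `2(ω-2) - δ - δ(ω+3) ≥ 9ε/8`, contradiction with `log 64 < ε log n`
  have hδε : δ * 8 = ε := by rw [hδ]; ring
  have hωε : ω = ε + 2 := by rw [hε]; ring
  have key : (2 - δ) * Real.log n - Real.log 64 + (2 - δ) * ω * Real.log n ≤ 3 * ((2 + δ) * Real.log n) := by
    linarith
  rw [hωε] at key
  nlinarith [hbig, hℓnpos, hεpos, hε1, hδε, mul_pos hεpos hℓnpos, mul_pos hδpos hℓnpos]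

end Summit.MatrixMultiplication.MatrixMultiplication.Theses.FourierTwoFamiliesModP
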